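import Summits.PneNP.PneNP.Theorems.ConvexRankGatesConvexGateBlindXorDefs
import Literature.Barriers.PneNP.TSPExtensionComplexityFarkas

/-!
# Calibration of `ExactLifting`: the exponent is at most the Sherali–Adams refutation degree

Support file for crux `ConvexGateBlind` (stmt-PneNP-10680), line `xor-door-perfect-completeness`, open stub
`stub_exactLifting` (lead c1; memo `ExactLifting-c1-analysis.md` §6, milestone (ii)).

`ExactLifting` asks for an unbounded `φ` with `q + r ≥ t^{φ(d)}` for every cone factorisation of the shifted
Index-lift `viol_F(x[w]) − ε` of every degree-`d` perfectly fooled `F`. This file proves the matching UPPER bound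
on what such a `φ` can be, i.e. it calibrates the stub:

* `conicJunta_of_saValue` — if the degree-`k` Sherali–Adams VALUE of `F` is at least `ε` (every linear functional
  that is non-negative on non-negative `k`-juntas and normalised has `Ẽ[viol_F] ≥ ε`; `k ≥ 3`), then `viol_F − ε`
  is a non-negative combination of junta indicators `1[y|_S = b]`, `#S ≤ k` (conic Farkas on the finite junta cone,
  `Literature.Barriers.PneNP.farkas`; the degenerate alternative `Ẽ[1] = 0` is excluded because the violation
  indicators are themselves `3`-juntas).
* `hasConeFact_shift_of_saValue` — lifting each junta indicator through the Index gadget costs `(2t)^{#S}`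
  rectangles `1[x|_S ∘ π = b] · 1[w|_S = π]`, so `viol_F(x[w]) − ε` has a non-negative factorisation with at most
  `#{S : #S ≤ k} · (2t)^k` terms, for every `t ≥ 1`.
* `exactLifting_exponent_le` — consequently any exponent function `φ` as in `ExactLifting` satisfies
  `φ(d) ≤ k` whenever SOME degree-`d` perfectly fooled unsatisfiable `F` has positive degree-`k` Sherali–Adams value
  (`k ≥ 3`): the stub can only hold with `φ(d) ≤ deg_SA`, the Sherali–Adams refutation degree of the easiest
  degree-`d`-fooled system — "size-from-degree" can never beat degree.
-/

set_option linter.dupNamespace false -- `Summit.PneNP.PneNP.…`: summit = sub-problem (D-0017)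

namespace Summit.PneNP.PneNP.Theorems.XorDoor

open scoped BigOperators Classical
open Finset Matrix

noncomputable section

/-! ## §1 Junta indicators and the junta decomposition -/

/-- A non-negative `k`-junta is a non-negative combination of the indicators `1[y|_S = b]` of its support set:
`h y = Σ_b h(ext b) · 1[y|_S = b]`, where `ext b` extends the pattern `b` by zero. -/
theorem junta_eq_sum_indicator {m : ℕ} (S : Finset (Fin m)) (h : (Fin m → ZMod 2) → ℝ)
    (hS : ∀ x y : Fin m → ZMod 2, (∀ i ∈ S, x i = y i) → h x = h y) (y : Fin m → ZMod 2) :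
    h y = ∑ b : {i // i ∈ S} → ZMod 2,
      h (fun i => if hi : i ∈ S then b ⟨i, hi⟩ else 0) *
        (if (∀ i : {i // i ∈ S}, y i.1 = b i) then (1 : ℝ) else 0) := by
  rw [Finset.sum_eq_single (fun i : {i // i ∈ S} => y i.1)]
  · have hx : h (fun i => if hi : i ∈ S then (fun j : {i // i ∈ S} => y j.1) ⟨i, hi⟩ else 0) = h y :=
      hS _ _ fun i hi => by simp [hi]
    rw [hx, if_pos (fun _ => rfl), mul_one]
  · intro b _ hb
    have : ¬ ∀ i : {i // i ∈ S}, y i.1 = b i := fun hall => hb (funext fun i => (hall i).symm)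
    rw [if_neg this, mul_zero]
  · intro hy
    exact absurd (Finset.mem_univ _) hy

/-! ## §2 Positive Sherali–Adams value ⇒ `viol_F − ε` is a conic junta -/

/-- **Conic Farkas for the junta cone.** If every linear functional that is non-negative on non-negative
`k`-juntas and normalised (`Ẽ[1] = 1`) has `Ẽ[viol_F] ≥ ε` — i.e. the degree-`k` Sherali–Adams value of `F` is at
least `ε` — and `k ≥ 3`, then `viol_F − ε = Σ_{(S,b)} λ_{S,b} 1[y|_S = b]` with `λ ≥ 0`, `#S ≤ k`. -/
theorem conicJunta_of_saValue {m k : ℕ} (hk : 3 ≤ k) (F : Finset (Pool m)) {ε : ℝ}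
    (hSA : ∀ E : ((Fin m → ZMod 2) → ℝ) →ₗ[ℝ] ℝ,
      (∀ h : (Fin m → ZMod 2) → ℝ, IsJunta k h → (∀ x, 0 ≤ h x) → 0 ≤ E h) →
      E (fun _ => 1) = 1 → ε ≤ E (fun y => (viol F y : ℝ))) :
    ∃ lam : (Σ S : {S : Finset (Fin m) // S.card ≤ k}, ({i // i ∈ S.1} → ZMod 2)) → ℝ,
      (∀ g, 0 ≤ lam g) ∧
      ∀ y : Fin m → ZMod 2, (viol F y : ℝ) - ε =
        ∑ g, lam g * (if (∀ i : {i // i ∈ g.1.1}, y i.1 = g.2 i) then (1 : ℝ) else 0) := by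
  -- generators: the junta indicators; target: `viol − ε`
  let gen : (Σ S : {S : Finset (Fin m) // S.card ≤ k}, ({i // i ∈ S.1} → ZMod 2)) → (Fin m → ZMod 2) → ℝ :=
    fun g y => if (∀ i : {i // i ∈ g.1.1}, y i.1 = g.2 i) then (1 : ℝ) else 0
  let tgt : (Fin m → ZMod 2) → ℝ := fun y => (viol F y : ℝ) - ε
  rcases Literature.Barriers.PneNP.farkas gen tgt with ⟨lam, hlam, htgt⟩ | ⟨Y, hY, hneg⟩
  · exact ⟨lam, hlam, fun y => htgt y⟩
  · exfalso
    -- the functional `E h := Σ_y h(y) Y(y)`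
    let E : ((Fin m → ZMod 2) → ℝ) →ₗ[ℝ] ℝ :=
      { toFun := fun h => ∑ y, h y * Y y
        map_add' := fun h h' => by
          simp only [Pi.add_apply, add_mul, Finset.sum_add_distrib]
        map_smul' := fun c h => by
          simp only [Pi.smul_apply, smul_eq_mul, RingHom.id_apply, Finset.mul_sum, mul_assoc] }
    have hEapp : ∀ h : (Fin m → ZMod 2) → ℝ, E h = ∑ y, h y * Y y := fun h => rfl
    -- `E` is non-negative on the generators, hence on all non-negative `k`-juntas
    have hEgen : ∀ g, 0 ≤ E (gen g) := fun g => by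
      rw [hEapp]
      simpa [dotProduct, gen] using hY g
    have hEjunta : ∀ h : (Fin m → ZMod 2) → ℝ, IsJunta k h → (∀ x, 0 ≤ h x) → 0 ≤ E h := by
      rintro h ⟨S, hSk, hS⟩ h0
      have hdec : h = ∑ b : {i // i ∈ S} → ZMod 2,
          h (fun i => if hi : i ∈ S then b ⟨i, hi⟩ else 0) • gen ⟨⟨S, hSk⟩, b⟩ := by
        funext y
        rw [junta_eq_sum_indicator S h hS y, Finset.sum_apply]
        simp only [Pi.smul_apply, smul_eq_mul, gen]
      rw [hdec, map_sum]
      exact Finset.sum_nonneg fun b _ => by rw [map_smul, smul_eq_mul]; exact mul_nonneg (h0 _) (hEgen _)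
    -- the target has negative value
    have hEtgt : E tgt < 0 := by
      rw [hEapp]
      simpa [dotProduct, tgt] using hneg
    have hone0 : 0 ≤ E (fun _ => 1) :=
      hEjunta _ ⟨∅, by simp, fun _ _ _ => rfl⟩ fun _ => zero_le_one
    have htgt_eq : E tgt = E (fun y => (viol F y : ℝ)) - ε * E (fun _ => 1) := by
      have : tgt = (fun y => (viol F y : ℝ)) - ε • (fun _ => (1 : ℝ)) := by
        funext y; simp [tgt]
      rw [this, map_sub, map_smul, smul_eq_mul]
    rcases hone0.lt_or_eq with hpos | hzero
    · -- normalise and contradict the Sherali–Adams value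
      let E' : ((Fin m → ZMod 2) → ℝ) →ₗ[ℝ] ℝ := (E (fun _ => 1))⁻¹ • E
      have hE'app : ∀ h, E' h = (E (fun _ => 1))⁻¹ * E h := fun h => rfl
      have h1 : E' (fun _ => 1) = 1 := by rw [hE'app, inv_mul_cancel₀ hpos.ne']
      have h2 : ∀ h : (Fin m → ZMod 2) → ℝ, IsJunta k h → (∀ x, 0 ≤ h x) → 0 ≤ E' h := fun h hj h0 => by
        rw [hE'app]; exact mul_nonneg (inv_nonneg.2 hone0) (hEjunta h hj h0)
      have h3 := hSA E' h2 h1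
      rw [hE'app] at h3
      -- `ε ≤ E[viol]/E[1]` contradicts `E[viol] − ε E[1] < 0`
      have h4 : ε * E (fun _ => 1) ≤ E (fun y => (viol F y : ℝ)) := by
        have := mul_le_mul_of_nonneg_right h3 hone0
        rwa [mul_comm ((E fun _ => 1)⁻¹) _, mul_assoc, inv_mul_cancel₀ hpos.ne', mul_one] at this
      linarith [hEtgt, htgt_eq]
    · -- degenerate alternative `E[1] = 0`: then `E` vanishes on every `k`-junta indicator, so on `viol_F`
      have hE1 : E (fun _ => 1) = 0 := hzero.symm
      -- every indicator with `#S ≤ k` has value `0`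
      have hind0 : ∀ (S : Finset (Fin m)) (hSk : S.card ≤ k) (b : {i // i ∈ S} → ZMod 2),
          E (gen ⟨⟨S, hSk⟩, b⟩) = 0 := by
        intro S hSk b
        -- `1 = Σ_b' 1[y|_S = b']`
        have hsum : (fun _ : Fin m → ZMod 2 => (1 : ℝ)) = ∑ b' : {i // i ∈ S} → ZMod 2, gen ⟨⟨S, hSk⟩, b'⟩ := by
          funext y
          rw [Finset.sum_apply, junta_eq_sum_indicator S (fun _ => (1 : ℝ)) (fun _ _ _ => rfl) y]
          simp [gen]
        have htot : ∑ b' : {i // i ∈ S} → ZMod 2, E (gen ⟨⟨S, hSk⟩, b'⟩) = 0 := by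
          rw [← map_sum, ← hsum, hE1]
        exact (Finset.sum_eq_zero_iff_of_nonneg fun b' _ => hEgen _).1 htot b (Finset.mem_univ b)
      -- `viol_F` is a sum of `3`-junta violation indicators
      have hviol0 : E (fun y => (viol F y : ℝ)) = 0 := by
        have hv : (fun y => (viol F y : ℝ)) = ∑ e ∈ F, fun y => if ¬ Sat y e then (1 : ℝ) else 0 := by
          funext y
          rw [Finset.sum_apply, viol, Finset.natCast_card_filter]
        rw [hv, map_sum]
        refine Finset.sum_eq_zero fun e _ => ?_
        -- the violation indicator of `e` is a junta on its scope `{e.1, e.2.1, e.2.2.1}`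
        let S : Finset (Fin m) := {e.1, e.2.1, e.2.2.1}
        have hSk : S.card ≤ k := le_trans (Finset.card_le_three) hk
        have hSj : ∀ x y : Fin m → ZMod 2, (∀ i ∈ S, x i = y i) →
            (fun y => if ¬ Sat y e then (1 : ℝ) else 0) x = (fun y => if ¬ Sat y e then (1 : ℝ) else 0) y := by
          intro x y hxy
          have h1 : x e.1 = y e.1 := hxy _ (by simp [S])
          have h2 : x e.2.1 = y e.2.1 := hxy _ (by simp [S])
          have h3 : x e.2.2.1 = y e.2.2.1 := hxy _ (by simp [S])
          have hiff : Sat x e ↔ Sat y e := by simp only [Sat, h1, h2, h3]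
          show (if ¬ Sat x e then (1 : ℝ) else 0) = (if ¬ Sat y e then (1 : ℝ) else 0)
          by_cases hs : Sat y e
          · rw [if_neg (not_not.2 (hiff.2 hs)), if_neg (not_not.2 hs)]
          · rw [if_pos (mt hiff.1 hs), if_pos hs]
        have hdec : (fun y => if ¬ Sat y e then (1 : ℝ) else 0) = ∑ b : {i // i ∈ S} → ZMod 2,
            (fun y => if ¬ Sat y e then (1 : ℝ) else 0) (fun i => if hi : i ∈ S then b ⟨i, hi⟩ else 0) •
              gen ⟨⟨S, hSk⟩, b⟩ := by
          funext y
          rw [junta_eq_sum_indicator S _ hSj y, Finset.sum_apply]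
          simp only [Pi.smul_apply, smul_eq_mul, gen]
        rw [hdec, map_sum]
        exact Finset.sum_eq_zero fun b _ => by rw [map_smul, smul_eq_mul, hind0 S hSk b, mul_zero]
      rw [htgt_eq, hviol0, hE1, mul_zero, sub_zero] at hEtgt
      exact lt_irrefl _ hEtgt

/-! ## §3 Lifting a conic junta: the shifted Index-lift factorises with `#{S} · (2t)^k` terms -/

/-- **Positive Sherali–Adams value ⇒ cheap factorisation of the shifted lift.** Under the hypothesis of
`conicJunta_of_saValue`, for every `t ≥ 1` the shifted Index-lift `viol_F(x[w]) − ε` has a non-negative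
(`q = 0`) factorisation with at most `#{S ⊆ Fin m : #S ≤ k} · (2t)^k` terms: lift each indicator
`1[y|_S = b]` as `Σ_π 1[x|_S ∘ π = b] · 1[w|_S = π]`. -/
theorem hasConeFact_shift_of_saValue {m k t : ℕ} (hk : 3 ≤ k) (ht : 1 ≤ t) (F : Finset (Pool m)) {ε : ℝ}
    (hSA : ∀ E : ((Fin m → ZMod 2) → ℝ) →ₗ[ℝ] ℝ,
      (∀ h : (Fin m → ZMod 2) → ℝ, IsJunta k h → (∀ x, 0 ≤ h x) → 0 ≤ E h) →
      E (fun _ => 1) = 1 → ε ≤ E (fun y => (viol F y : ℝ))) :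
    ∃ r : ℕ, r ≤ Fintype.card {S : Finset (Fin m) // S.card ≤ k} * (2 * t) ^ k ∧
      HasConeFact (fun (x : Fin m → Fin t → ZMod 2) (w : Fin m → Fin t) =>
        (viol F (fun i => x i (w i)) : ℝ) - ε) 0 r := by
  obtain ⟨lam, hlam, hdec⟩ := conicJunta_of_saValue hk F hSA
  -- index type of the lifted rectangles
  let L : Type := Σ S : {S : Finset (Fin m) // S.card ≤ k}, ({i // i ∈ S.1} → ZMod 2) × ({i // i ∈ S.1} → Fin t)
  -- the count
  have hcardL : Fintype.card L ≤ Fintype.card {S : Finset (Fin m) // S.card ≤ k} * (2 * t) ^ k := by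
    show Fintype.card (Σ S : {S : Finset (Fin m) // S.card ≤ k},
        ({i // i ∈ S.1} → ZMod 2) × ({i // i ∈ S.1} → Fin t)) ≤ _
    rw [Fintype.card_sigma]
    have hfib : ∀ S : {S : Finset (Fin m) // S.card ≤ k},
        Fintype.card (({i // i ∈ S.1} → ZMod 2) × ({i // i ∈ S.1} → Fin t)) ≤ (2 * t) ^ k := by
      intro S
      rw [Fintype.card_prod, Fintype.card_fun, Fintype.card_fun, ZMod.card, Fintype.card_fin,
        Fintype.card_coe, ← mul_pow]
      exact Nat.pow_le_pow_right (by omega) S.2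
    calc ∑ S, Fintype.card (({i // i ∈ S.1} → ZMod 2) × ({i // i ∈ S.1} → Fin t))
        ≤ ∑ _S : {S : Finset (Fin m) // S.card ≤ k}, (2 * t) ^ k := Finset.sum_le_sum fun S _ => hfib S
      _ = Fintype.card {S : Finset (Fin m) // S.card ≤ k} * (2 * t) ^ k := by
          rw [Finset.sum_const, Finset.card_univ, smul_eq_mul]
  -- the factors
  let U : (Fin m → Fin t → ZMod 2) → L → ℝ := fun x g =>
    lam ⟨g.1, g.2.1⟩ * (if (∀ i : {i // i ∈ g.1.1}, x i.1 (g.2.2 i) = g.2.1 i) then (1 : ℝ) else 0)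
  let V : L → (Fin m → Fin t) → ℝ := fun g w =>
    if (∀ i : {i // i ∈ g.1.1}, w i.1 = g.2.2 i) then (1 : ℝ) else 0
  have hU0 : ∀ x g, 0 ≤ U x g := fun x g => mul_nonneg (hlam _) (by positivity)
  have hV0 : ∀ g w, 0 ≤ V g w := fun g w => by positivity
  -- the identity
  have hid : ∀ (x : Fin m → Fin t → ZMod 2) (w : Fin m → Fin t),
      (viol F (fun i => x i (w i)) : ℝ) - ε = ∑ g : L, U x g * V g w := by
    intro x w
    rw [hdec (fun i => x i (w i))]
    show _ = ∑ g : (Σ S : {S : Finset (Fin m) // S.card ≤ k},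
        ({i // i ∈ S.1} → ZMod 2) × ({i // i ∈ S.1} → Fin t)), U x g * V g w
    rw [Fintype.sum_sigma, Fintype.sum_sigma]
    refine Finset.sum_congr rfl fun S _ => ?_
    rw [Fintype.sum_prod_type]
    refine Finset.sum_congr rfl fun b _ => ?_
    -- exactly one pointer pattern `π = w|_S` contributes
    rw [Finset.sum_eq_single (fun i : {i // i ∈ S.1} => w i.1)]
    · simp only [U, V]
      simp
    · intro π _ hπ
      have : ¬ ∀ i : {i // i ∈ S.1}, w i.1 = π i := fun hall => hπ (funext fun i => (hall i).symm)
      simp only [U, V, this, if_false, mul_zero]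
    · intro h; exact absurd (Finset.mem_univ _) h
  -- assemble
  let eL : L ≃ Fin (Fintype.card L) := Fintype.equivFin L
  refine ⟨Fintype.card L, hcardL, fun _ => 0, fun _ => 0, fun x l => U x (eL.symm l), fun l w => V (eL.symm l) w,
    fun _ => Matrix.PosSemidef.zero, fun _ => Matrix.PosSemidef.zero, fun x l => hU0 x _, fun l w => hV0 _ w,
    fun x w => ?_⟩
  rw [Matrix.zero_mul, Matrix.trace_zero, zero_add, eL.symm.sum_comp (fun g => U x g * V g w)]
  exact hid x w

/-! ## §4 The calibration of `ExactLifting` -/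

/-- Elementary: if `t^a ≤ C · t^k` for all large `t`, then `a ≤ k`. -/
theorem exponent_le_of_pow_le {a k C T : ℕ} (h : ∀ t : ℕ, T ≤ t → t ^ a ≤ C * t ^ k) : a ≤ k := by
  by_contra hak
  have hak' : k + 1 ≤ a := by omega
  let t : ℕ := max T (C + 1)
  have hT : T ≤ t := le_max_left _ _
  have hC : C + 1 ≤ t := le_max_right _ _
  have ht1 : 1 ≤ t := le_trans (Nat.succ_le_succ (Nat.zero_le C)) hC
  have h1 := h t hT
  have h2 : C * t ^ k < t ^ a := by
    calc C * t ^ k < t * t ^ k := Nat.mul_lt_mul_of_pos_right (by omega) (Nat.pow_pos (by omega))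
      _ = t ^ (k + 1) := by ring
      _ ≤ t ^ a := Nat.pow_le_pow_right ht1 hak'
  omega

/-- **Calibration of `ExactLifting`.** Let `φ` be an exponent function as in `ExactLifting` (the bound
`t^{φ(d)} ≤ q + r` for every cone factorisation of the shifted lift of every degree-`d` perfectly fooled
unsatisfiable `F`). If some degree-`d` perfectly fooled unsatisfiable `F` has positive degree-`k` Sherali–Adams
value (`k ≥ 3`; some `ε > 0` below every normalised functional non-negative on non-negative `k`-juntas), then
`φ(d) ≤ k`. So `ExactLifting` can only hold with `φ(d) ≤` the Sherali–Adams refutation degree of the easiest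
degree-`d`-fooled system. -/
theorem exactLifting_exponent_le (φ : ℕ → ℕ)
    (hφ : ∀ (m d : ℕ) (F : Finset (Pool m)),
      (¬ ∃ y : Fin m → ZMod 2, ∀ e ∈ F, Sat y e) → HasPerfectPseudoExp d F →
      ∃ T : ℕ, ∀ (t : ℕ) (ε : ℝ), T ≤ t → 0 < ε → ∀ q r : ℕ,
        HasConeFact (fun (x : Fin m → Fin t → ZMod 2) (w : Fin m → Fin t) =>
          (viol F (fun i => x i (w i)) : ℝ) - ε) q r →
        t ^ φ d ≤ q + r)
    {m d k : ℕ} (hk : 3 ≤ k) (F : Finset (Pool m)) (hunsat : ¬ ∃ y : Fin m → ZMod 2, ∀ e ∈ F, Sat y e)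
    (hE : HasPerfectPseudoExp d F) {ε : ℝ} (hε : 0 < ε)
    (hSA : ∀ E : ((Fin m → ZMod 2) → ℝ) →ₗ[ℝ] ℝ,
      (∀ h : (Fin m → ZMod 2) → ℝ, IsJunta k h → (∀ x, 0 ≤ h x) → 0 ≤ E h) →
      E (fun _ => 1) = 1 → ε ≤ E (fun y => (viol F y : ℝ))) :
    φ d ≤ k := by
  obtain ⟨T, hT⟩ := hφ m d F hunsat hE
  refine exponent_le_of_pow_le (C := Fintype.card {S : Finset (Fin m) // S.card ≤ k} * 2 ^ k)
    (T := max T 1) fun t ht => ?_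
  have hT' : T ≤ t := le_trans (le_max_left _ _) ht
  have ht1 : 1 ≤ t := le_trans (le_max_right _ _) ht
  obtain ⟨r, hr, hfact⟩ := hasConeFact_shift_of_saValue hk ht1 F hSA
  have h := hT t ε hT' hε 0 r hfact
  calc t ^ φ d ≤ 0 + r := h
    _ ≤ Fintype.card {S : Finset (Fin m) // S.card ≤ k} * (2 * t) ^ k := by rw [zero_add]; exact hr
    _ = Fintype.card {S : Finset (Fin m) // S.card ≤ k} * 2 ^ k * t ^ k := by rw [mul_pow]; ring

/-- **Calibration, packaged against the stub.** `ExactLifting` implies: its exponent function is bounded by the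
Sherali–Adams degree — for every `d` and every `k ≥ 3`, if some degree-`d` perfectly fooled unsatisfiable system
has positive degree-`k` Sherali–Adams value then `φ(d) ≤ k`. -/
theorem exactLifting_calibration : ExactLifting →
    ∃ φ : ℕ → ℕ, (∀ K : ℕ, ∃ d : ℕ, K ≤ φ d) ∧
      ∀ (m d k : ℕ) (F : Finset (Pool m)), 3 ≤ k →
        (¬ ∃ y : Fin m → ZMod 2, ∀ e ∈ F, Sat y e) → HasPerfectPseudoExp d F →
        (∃ ε : ℝ, 0 < ε ∧ ∀ E : ((Fin m → ZMod 2) → ℝ) →ₗ[ℝ] ℝ,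
          (∀ h : (Fin m → ZMod 2) → ℝ, IsJunta k h → (∀ x, 0 ≤ h x) → 0 ≤ E h) →
          E (fun _ => 1) = 1 → ε ≤ E (fun y => (viol F y : ℝ))) →
        (∀ (m' d' : ℕ) (F' : Finset (Pool m')),
          (¬ ∃ y : Fin m' → ZMod 2, ∀ e ∈ F', Sat y e) → HasPerfectPseudoExp d' F' →
          ∃ T : ℕ, ∀ (t : ℕ) (ε : ℝ), T ≤ t → 0 < ε → ∀ q r : ℕ,
            HasConeFact (fun (x : Fin m' → Fin t → ZMod 2) (w : Fin m' → Fin t) =>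
              (viol F' (fun i => x i (w i)) : ℝ) - ε) q r → t ^ φ d' ≤ q + r) ∧
        φ d ≤ k := by
  rintro ⟨φ, hφu, hφ⟩
  refine ⟨φ, hφu, fun m d k F hk hunsat hE ⟨ε, hε, hSA⟩ => ⟨hφ, ?_⟩⟩
  exact exactLifting_exponent_le φ hφ hk F hunsat hE hε hSA

end

end Summit.PneNP.PneNP.Theorems.XorDoor
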